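import Mathlib.Analysis.Calculus.Rademacher
import Mathlib.Analysis.Calculus.FDeriv.Measurable
import Mathlib.Analysis.Calculus.ParametricIntegral
import Literature.Analysis.FunctionSpaces.TorusConvolution
import HarnessLib

/-!
# Rademacher's theorem on the flat torus and derivatives of mollified Lipschitz functions

Analysis/FunctionSpaces support file (everything proved). It serves the discharge of the named
facts `Literature.Analysis.FluidPDE.Seis2022_rmk1_L2` / `Seis2022_thm2_L2`
(`FluidPDE/SeisDissipationRateBound`), where the (Lipschitz, non-smooth) optimal Kantorovich
potentials `ζ` of `KantorovichLogDistance` are paired with velocity fields through `∇ζ` and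
regularised by the standard mollifier, `ζ ⋆ k_ε`.

For a `K`-Lipschitz `ζ : T^d → ℝ` (torus = quotient sup metric):

* `Torus.lipschitzWith_lift` — the periodic lift `ζ ∘ proj : ℝ^d → ℝ` is `K`-Lipschitz
  (`‖proj v‖ ≤ ‖v‖`);
* `Torus.ae_differentiableAt_liftAt` — **Rademacher on `T^d`**: for a.e. `x ∈ T^d` the centred
  lift `v ↦ ζ (x + proj v)` is differentiable at `0` (Mathlib's `LipschitzWith.ae_differentiableAt`
  on `ℝ^d`, transported along the measure-preserving section `Torus.repr`), so that
  `Torus.fderiv ζ x` / `Torus.gradient ζ x` are genuine derivatives there, with the slope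
  convergence `(ζ (x + proj (t w)) - ζ x)/t → ⟪∇ζ x, w⟫` (`Torus.tendsto_slope_of_differentiableAt`);
* `Torus.norm_torusFderiv_le_of_lipschitz`, `Torus.norm_gradient_le_of_lipschitz` — `‖Dζ x‖,
  ‖∇ζ x‖ ≤ K` for **every** `x` (junk value `0` where not differentiable);
* `Torus.measurable_torusFderiv`, `Torus.measurable_gradient` — measurability of `x ↦ Dζ x`,
  `∇ζ x` for every `ζ` (Mathlib's `measurable_fderiv`, through `Dζ x = D(ζ ∘ proj)(repr x)`);
* `Torus.torusFderiv_convolution_of_lipschitz`, `Torus.gradient_convolution_of_lipschitz` —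
  **the derivative passes onto the Lipschitz factor**: `D(ζ ⋆ k)(x) w = ∫ k(x - y) Dζ(y) w dy` and
  `∇(ζ ⋆ k)(x) = ∫ k(x - y) • ∇ζ(y) dy` for smooth `k` (differentiation under the integral sign
  with a Lipschitz bound, Mathlib's `hasDerivAt_integral_of_dominated_loc_of_lip`, the a.e.
  derivative existing by Rademacher).

## Mathlib / tree search

Mathlib (this pin): Rademacher (`LipschitzWith.ae_differentiableAt`, finite-dimensional real
spaces with an additive Haar measure), `measurable_fderiv`, `norm_fderiv_le_of_lipschitz`,
parametric differentiation `hasDerivAt_integral_of_dominated_loc_of_lip`; nothing on quotient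
tori. Tree: `Torus.fderiv_lift`, `Torus.liftAt_eq_lift_comp_add`, `Torus.measurePreserving_repr`
(`FlatTorus(Proofs)`, `TorusCalculus`), mollification `TorusConvolution`.

## References

* H. Federer, *Geometric Measure Theory* (1969), 3.1.6 (Rademacher's theorem).
* L. C. Evans, *Partial Differential Equations*, 2nd ed. (2010), §5.8.3 Thm. 6 and App. C.4.
-/

noncomputable section

open MeasureTheory Set Filter Metric Function Topology
open scoped Topology Convolution InnerProductSpace

namespace Literature.Analysis.FunctionSpaces

namespace Torus

variable {d : Type*} [Fintype d]
variable {F : Type*} [NormedAddCommGroup F] [NormedSpace ℝ F]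

/-! ## Lipschitz functions and their lifts -/

/-- The covering map is `1`-Lipschitz: `dist (proj a) (proj b) ≤ ‖a - b‖` (also in
`TorusSpaceTimeCutoff`, not imported here to keep the import closure small). [folklore] -/
private theorem dist_proj_proj_le_norm (a b : EuclideanSpace ℝ d) : dist (proj a) (proj b) ≤ ‖a - b‖ := by
  rw [dist_eq_norm, ← proj_sub]
  exact norm_proj_le _

omit [NormedSpace ℝ F] in
/-- **The periodic lift of a Lipschitz function is Lipschitz** with the same constant. [folklore] -/
theorem lipschitzWith_lift {K : NNReal} {ζ : UnitAddTorus d → F} (h : LipschitzWith K ζ) :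
    LipschitzWith K (lift ζ) :=
  LipschitzWith.of_dist_le_mul fun a b => by
    rw [lift_apply, lift_apply]
    exact (h.dist_le_mul _ _).trans (mul_le_mul_of_nonneg_left (dist_proj_proj_le_norm a b) K.2)

omit [NormedSpace ℝ F] in
/-- The centred lift of a Lipschitz function is Lipschitz with the same constant. [folklore] -/
theorem lipschitzWith_liftAt {K : NNReal} {ζ : UnitAddTorus d → F} (h : LipschitzWith K ζ)
    (x : UnitAddTorus d) : LipschitzWith K (liftAt ζ x) :=
  LipschitzWith.of_dist_le_mul fun a b => by
    rw [liftAt_apply, liftAt_apply]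
    refine (h.dist_le_mul _ _).trans (mul_le_mul_of_nonneg_left ?_ K.2)
    rw [dist_add_left]
    exact dist_proj_proj_le_norm a b

/-! ## Derivatives: junk-robust identities, bounds and measurability -/

/-- `Dζ x = D(ζ ∘ proj)(repr x)`: the torus derivative through the global lift at the
canonical representative. [folklore] -/
theorem torusFderiv_eq_fderiv_lift_repr (ζ : UnitAddTorus d → F) (x : UnitAddTorus d) :
    Torus.fderiv ζ x = _root_.fderiv ℝ (lift ζ) (repr x) := by
  rw [fderiv_lift, proj_repr]

/-- `∇ζ x = (toDual)⁻¹ (Dζ x)`. [folklore] -/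
theorem gradient_eq_toDual_symm_torusFderiv (ζ : UnitAddTorus d → ℝ) (x : UnitAddTorus d) :
    Torus.gradient ζ x = (InnerProductSpace.toDual ℝ (EuclideanSpace ℝ d)).symm (Torus.fderiv ζ x) :=
  rfl

/-- `‖∇ζ x‖ = ‖Dζ x‖`. [folklore] -/
theorem norm_gradient_eq_norm_torusFderiv (ζ : UnitAddTorus d → ℝ) (x : UnitAddTorus d) :
    ‖Torus.gradient ζ x‖ = ‖Torus.fderiv ζ x‖ := by
  rw [gradient_eq_toDual_symm_torusFderiv, LinearIsometryEquiv.norm_map]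

-- `⟪∇ζ x, w⟫ = Dζ x w` is `Torus.inner_gradient_left` (`TorusCalculusProofs`).

/-- **Measurability of the torus derivative**, for every `ζ` (Mathlib's `measurable_fderiv`). [folklore] -/
theorem measurable_torusFderiv [CompleteSpace F] [MeasurableSpace F] [BorelSpace F]
    (ζ : UnitAddTorus d → F) : Measurable (Torus.fderiv ζ) := by
  have e : Torus.fderiv ζ = _root_.fderiv ℝ (lift ζ) ∘ repr := funext (torusFderiv_eq_fderiv_lift_repr ζ)
  rw [e]
  exact (measurable_fderiv ℝ (lift ζ)).comp measurable_repr

/-- **Measurability of the torus gradient**, for every real `ζ`. [folklore] -/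
theorem measurable_gradient (ζ : UnitAddTorus d → ℝ) : Measurable (Torus.gradient ζ) := by
  have e : Torus.gradient ζ =
      (InnerProductSpace.toDual ℝ (EuclideanSpace ℝ d)).symm ∘ Torus.fderiv ζ :=
    funext (gradient_eq_toDual_symm_torusFderiv ζ)
  rw [e]
  exact (InnerProductSpace.toDual ℝ (EuclideanSpace ℝ d)).symm.continuous.measurable.comp
    (measurable_torusFderiv ζ)

/-- `‖Dζ x‖ ≤ K` everywhere for `K`-Lipschitz `ζ` (Mathlib `norm_fderiv_le_of_lipschitz`). [folklore] -/
theorem norm_torusFderiv_le_of_lipschitz {K : NNReal} {ζ : UnitAddTorus d → F} (h : LipschitzWith K ζ)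
    (x : UnitAddTorus d) : ‖Torus.fderiv ζ x‖ ≤ K :=
  norm_fderiv_le_of_lipschitz ℝ (lipschitzWith_liftAt h x)

/-- `‖∇ζ x‖ ≤ K` everywhere for `K`-Lipschitz real `ζ`. [folklore] -/
theorem norm_gradient_le_of_lipschitz {K : NNReal} {ζ : UnitAddTorus d → ℝ} (h : LipschitzWith K ζ)
    (x : UnitAddTorus d) : ‖Torus.gradient ζ x‖ ≤ K := by
  rw [norm_gradient_eq_norm_torusFderiv]
  exact norm_torusFderiv_le_of_lipschitz h x

/-- `|Dζ x w| ≤ K ‖w‖`. [folklore] -/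
theorem norm_torusFderiv_apply_le_of_lipschitz {K : NNReal} {ζ : UnitAddTorus d → F}
    (h : LipschitzWith K ζ) (x : UnitAddTorus d) (w : EuclideanSpace ℝ d) :
    ‖Torus.fderiv ζ x w‖ ≤ K * ‖w‖ :=
  (ContinuousLinearMap.le_opNorm _ _).trans
    (mul_le_mul_of_nonneg_right (norm_torusFderiv_le_of_lipschitz h x) (norm_nonneg _))

/-! ## Rademacher's theorem on the torus -/

/-- **Rademacher's theorem on `T^d`.** For a Lipschitz `ζ : T^d → F` (`F` a finite-dimensional
real space) and a.e. `x ∈ T^d`, the centred lift `v ↦ ζ (x + proj v)` is differentiable at `0`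
(Rademacher on `ℝ^d` for the lift, transported along the measure-preserving `Torus.repr`).
[folklore] -/
theorem ae_differentiableAt_liftAt [FiniteDimensional ℝ F] {K : NNReal} {ζ : UnitAddTorus d → F}
    (h : LipschitzWith K ζ) :
    ∀ᵐ x ∂(volume : Measure (UnitAddTorus d)), DifferentiableAt ℝ (liftAt ζ x) 0 := by
  have hE : ∀ᵐ a ∂(volume : Measure (EuclideanSpace ℝ d)), DifferentiableAt ℝ (lift ζ) a :=
    (lipschitzWith_lift h).ae_differentiableAt
  have hE' : ∀ᵐ a ∂((volume : Measure (EuclideanSpace ℝ d)).restrict (unitCube d)),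
      DifferentiableAt ℝ (lift ζ) a := ae_restrict_of_ae hE
  have hT := (measurePreserving_repr (d := d)).quasiMeasurePreserving.ae hE'
  filter_upwards [hT] with x hx
  rw [liftAt_eq_lift_comp_add ζ (repr x) (proj_repr x)]
  refine DifferentiableAt.comp (0 : EuclideanSpace ℝ d) (by rw [add_zero]; exact hx) ?_
  exact (differentiableAt_const _).add differentiableAt_id

omit [Fintype d] in
/-- At a point of differentiability, `Dζ x` is the Fréchet derivative of the centred lift. [folklore] -/
theorem hasFDerivAt_liftAt {ζ : UnitAddTorus d → F} {x : UnitAddTorus d}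
    (hx : DifferentiableAt ℝ (liftAt ζ x) 0) : HasFDerivAt (liftAt ζ x) (Torus.fderiv ζ x) 0 :=
  hx.hasFDerivAt

/-- **Slopes converge to the directional derivative** at points of differentiability:
`(ζ (x + proj (t • w)) - ζ x)/t → Dζ x w` as `t → 0`, `t ≠ 0`. [folklore] -/
theorem tendsto_slope_of_differentiableAt {ζ : UnitAddTorus d → F} {x : UnitAddTorus d}
    (hx : DifferentiableAt ℝ (liftAt ζ x) 0) (w : EuclideanSpace ℝ d) :
    Tendsto (fun t : ℝ => t⁻¹ • (ζ (x + proj (t • w)) - ζ x)) (𝓝[≠] 0) (𝓝 (Torus.fderiv ζ x w)) := by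
  have h1 : HasLineDerivAt ℝ (liftAt ζ x) (Torus.fderiv ζ x w) 0 w :=
    (hasFDerivAt_liftAt hx).hasLineDerivAt w
  have h2 : HasDerivAt (fun t : ℝ => liftAt ζ x (0 + t • w)) (Torus.fderiv ζ x w) 0 := h1
  rw [hasDerivAt_iff_tendsto_slope] at h2
  refine h2.congr' ?_
  filter_upwards [self_mem_nhdsWithin] with t ht
  simp [slope, liftAt_apply, proj_zero]

/-- Real-valued form: `(ζ (x + proj (t • w)) - ζ x)/t → ⟪∇ζ x, w⟫`. [folklore] -/
theorem tendsto_div_of_differentiableAt {ζ : UnitAddTorus d → ℝ} {x : UnitAddTorus d}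
    (hx : DifferentiableAt ℝ (liftAt ζ x) 0) (w : EuclideanSpace ℝ d) :
    Tendsto (fun t : ℝ => (ζ (x + proj (t • w)) - ζ x) / t) (𝓝[≠] 0)
      (𝓝 ⟪Torus.gradient ζ x, w⟫_ℝ) := by
  rw [inner_gradient_left]
  refine (tendsto_slope_of_differentiableAt hx w).congr fun t => ?_
  rw [smul_eq_mul, div_eq_inv_mul]

/-! ## Derivatives of mollified Lipschitz functions -/

/-- A translate of the a.e. differentiability set: for a.e. `y`, the centred lift of `ζ` at
`x - y` is differentiable at `0`. [folklore] -/
theorem ae_differentiableAt_liftAt_sub [FiniteDimensional ℝ F] {K : NNReal} {ζ : UnitAddTorus d → F}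
    (h : LipschitzWith K ζ) (x : UnitAddTorus d) :
    ∀ᵐ y ∂(volume : Measure (UnitAddTorus d)), DifferentiableAt ℝ (liftAt ζ (x - y)) 0 :=
  (Measure.measurePreserving_sub_left volume x).quasiMeasurePreserving.ae (ae_differentiableAt_liftAt h)

/-- **Differentiating a mollified Lipschitz function under the integral sign.** For
`K`-Lipschitz `ζ : T^d → F` (`F` finite-dimensional), continuous `k`, every `x` and direction
`w`: `t ↦ ∫ k(y) ζ(x + proj (t w) - y) dy` has derivative `∫ k(y) Dζ(x - y) w dy` at `t = 0`
(Mathlib's `hasDerivAt_integral_of_dominated_loc_of_lip`; the a.e. derivative exists by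
Rademacher). [folklore] -/
theorem hasDerivAt_integral_kernel_comp_sub [FiniteDimensional ℝ F] {K : NNReal}
    {ζ : UnitAddTorus d → F} (h : LipschitzWith K ζ) {k : UnitAddTorus d → ℝ} (hk : Continuous k)
    (x : UnitAddTorus d) (w : EuclideanSpace ℝ d) :
    HasDerivAt (fun t : ℝ => ∫ y, k y • ζ (x + proj (t • w) - y))
      (∫ y, k y • Torus.fderiv ζ (x - y) w) 0 := by
  borelize F
  have hζc : Continuous ζ := h.continuous
  obtain ⟨C, hC⟩ := exists_forall_norm_le_of_continuous hk
  have hmeas : ∀ t : ℝ, AEStronglyMeasurable (fun y => k y • ζ (x + proj (t • w) - y)) volume :=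
    fun t => (hk.smul (hζc.comp (continuous_const.sub continuous_id))).aestronglyMeasurable
  have hint : Integrable (fun y => k y • ζ (x + proj ((0 : ℝ) • w) - y)) volume :=
    (hk.smul (hζc.comp (continuous_const.sub continuous_id))).integrable_unitAddTorus
  have hF'm : AEStronglyMeasurable (fun y => k y • Torus.fderiv ζ (x - y) w) volume := by
    refine (hk.aestronglyMeasurable.smul ?_)
    have hm : Measurable fun y => Torus.fderiv ζ (x - y) w :=
      (ContinuousLinearMap.apply ℝ F w).continuous.measurable.comp
        ((measurable_torusFderiv ζ).comp (measurable_const.sub measurable_id))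
    exact hm.aestronglyMeasurable
  set bound : UnitAddTorus d → ℝ := fun y => |k y| * (K * ‖w‖) with hbound
  have hlip : ∀ᵐ y ∂(volume : Measure (UnitAddTorus d)),
      LipschitzOnWith (Real.nnabs (bound y)) (fun t : ℝ => k y • ζ (x + proj (t • w) - y))
        (ball (0 : ℝ) 1) := by
    refine Eventually.of_forall fun y => ?_
    refine LipschitzOnWith.of_dist_le_mul fun t _ s _ => ?_
    have hb : (Real.nnabs (bound y) : ℝ) = |k y| * (K * ‖w‖) := by
      rw [Real.coe_nnabs, hbound, abs_of_nonneg (by positivity)]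
    rw [hb, dist_eq_norm, ← smul_sub, norm_smul, Real.norm_eq_abs, mul_assoc]
    refine mul_le_mul_of_nonneg_left ?_ (abs_nonneg _)
    rw [← dist_eq_norm]
    calc dist (ζ (x + proj (t • w) - y)) (ζ (x + proj (s • w) - y))
        ≤ K * dist (x + proj (t • w) - y) (x + proj (s • w) - y) := h.dist_le_mul _ _
      _ ≤ K * (‖w‖ * dist t s) := by
          refine mul_le_mul_of_nonneg_left ?_ K.2
          rw [dist_eq_norm, dist_eq_norm]
          have e : x + proj (t • w) - y - (x + proj (s • w) - y) = proj ((t - s) • w) := by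
            rw [sub_smul]
            simp only [proj_sub]
            abel
          rw [e]
          refine (norm_proj_le _).trans ?_
          rw [norm_smul, Real.norm_eq_abs, mul_comm]
      _ = K * ‖w‖ * dist t s := by ring
  have hbi : Integrable bound volume := (hk.abs.mul continuous_const).integrable_unitAddTorus
  have hdiff : ∀ᵐ y ∂(volume : Measure (UnitAddTorus d)),
      HasDerivAt (fun t : ℝ => k y • ζ (x + proj (t • w) - y)) (k y • Torus.fderiv ζ (x - y) w) 0 := by
    filter_upwards [ae_differentiableAt_liftAt_sub h x] with y hy
    have h1 : HasLineDerivAt ℝ (liftAt ζ (x - y)) (Torus.fderiv ζ (x - y) w) 0 w :=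
      (hasFDerivAt_liftAt hy).hasLineDerivAt w
    have h2 : HasDerivAt (fun t : ℝ => liftAt ζ (x - y) (0 + t • w)) (Torus.fderiv ζ (x - y) w) 0 := h1
    have h3 : HasDerivAt (fun t : ℝ => ζ (x + proj (t • w) - y)) (Torus.fderiv ζ (x - y) w) 0 := by
      refine h2.congr_of_eventuallyEq (Eventually.of_forall fun t => ?_)
      simp only [liftAt_apply, zero_add]
      congr 1
      abel
    exact h3.const_smul (k y)
  exact (hasDerivAt_integral_of_dominated_loc_of_lip (ball_mem_nhds (0 : ℝ) zero_lt_one)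
    (Eventually.of_forall hmeas) hint hF'm hlip hbi hdiff).2

/-- **The derivative of a mollified Lipschitz function**: for `K`-Lipschitz real `ζ` and
smooth real `k`, `D(ζ ⋆ k)(x) w = ∫ k(x - y) Dζ(y) w dy` (the derivative falls on the Lipschitz
factor, whose a.e. derivative exists by Rademacher; Evans, §5.8.3 Thm. 6 with App. C.4). [folklore] -/
theorem torusFderiv_convolution_of_lipschitz {K : NNReal} {ζ : UnitAddTorus d → ℝ}
    (h : LipschitzWith K ζ) {k : UnitAddTorus d → ℝ} (hk : IsSmooth k) (x : UnitAddTorus d)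
    (w : EuclideanSpace ℝ d) :
    Torus.fderiv (ζ ⋆ k) x w = ∫ y, k (x - y) * Torus.fderiv ζ y w := by
  have hζi : Integrable ζ volume := h.continuous.integrable_unitAddTorus
  have h1 : IsContDiff 1 (ζ ⋆ k) := (isSmooth_convolution hζi hk).isContDiff (by simp)
  rw [← lineDeriv_eq_fderiv_apply h1, lineDeriv]
  -- rewrite the mollification with the kernel variable first
  have hfun : (fun t : ℝ => (ζ ⋆ k) (x + proj (t • w))) =
      fun t : ℝ => ∫ y, k y • ζ (x + proj (t • w) - y) := by
    funext t
    rw [convolution_comm_real, convolution_lsmul]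
  rw [hfun, (hasDerivAt_integral_kernel_comp_sub h hk.continuous x w).deriv]
  -- change variables `y ↦ x - y`
  have e := integral_sub_left_eq_self (fun y => k (x - y) * Torus.fderiv ζ y w) volume x
  simp only [sub_sub_cancel] at e
  simp only [smul_eq_mul]
  exact e

/-- **The gradient of a mollified Lipschitz function**: `∇(ζ ⋆ k)(x) = ∫ k(x - y) • ∇ζ(y) dy`
for `K`-Lipschitz real `ζ` and smooth real `k`. [folklore] -/
theorem gradient_convolution_of_lipschitz {K : NNReal} {ζ : UnitAddTorus d → ℝ}
    (h : LipschitzWith K ζ) {k : UnitAddTorus d → ℝ} (hk : IsSmooth k) (x : UnitAddTorus d) :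
    Torus.gradient (ζ ⋆ k) x = ∫ y, k (x - y) • Torus.gradient ζ y := by
  have hkc : Continuous fun y => k (x - y) := hk.continuous.comp (continuous_const.sub continuous_id)
  obtain ⟨C, hC⟩ := exists_forall_norm_le_of_continuous hk.continuous
  have hi : Integrable (fun y => k (x - y) • Torus.gradient ζ y) volume := by
    refine Integrable.mono' ((integrable_const (C * K : ℝ)))
      (hkc.aestronglyMeasurable.smul (measurable_gradient ζ).aestronglyMeasurable)
      (Eventually.of_forall fun y => ?_)
    rw [norm_smul]
    exact mul_le_mul (hC _) (norm_gradient_le_of_lipschitz h y) (norm_nonneg _)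
      ((norm_nonneg (k x)).trans (hC x))
  refine ext_inner_right ℝ fun w => ?_
  rw [inner_gradient_left, torusFderiv_convolution_of_lipschitz h hk x w,
    real_inner_comm, ← integral_inner hi w]
  refine integral_congr_ae (Eventually.of_forall fun y => ?_)
  show k (x - y) * Torus.fderiv ζ y w = ⟪w, k (x - y) • Torus.gradient ζ y⟫_ℝ
  rw [real_inner_smul_right, real_inner_comm, inner_gradient_left]

end Torus

end Literature.Analysis.FunctionSpaces
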